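import Summits.QuantumFields.YangMills.Theorems.PoincareLipschitzLatticeToContinuumEnergyConvergence
import Summits.QuantumFields.YangMills.Theorems.PoincareLipschitzLatticeToContinuumMinimality
import Summits.QuantumFields.YangMills.Theorems.PoincareLipschitzBlowDownWeakGradient
import Summits.QuantumFields.YangMills.Theorems.PoincareLipschitzBlowDownEnergyLscEps
import Summits.QuantumFields.YangMills.Theorems.PoincareLipschitzDyadicMeansWeakLimitCube
import HarnessLib

/-!
# LINE 25 «CompactnessTransfer» (K2 crux `BlockLipschitzL` stmt-QuantumFields-23533 ∕ crux of record `HistoryTailL` stmt-QuantumFields-19936) —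
# (Γ-KNIT) «S2♭″ FROM THE BRICKS»: the registered stub `stub_latticeToContinuumLimit` (v1.4-band A″, skeleton 5f6c9044e172a9d7, text 1e033e6a3fd7fedf)
# GIVEN ONLY the (Γ5) brick «Sobolev sampling consistency» as a hypothesis `hΓ5` (pens w7 g13 ∕ px5 g8 ∕ px15 g6 ∕ w4 g15; replaced by the tree name when
# ✓`PoincareLipschitzSobolevSamplingConsistency.exists_unit_sample_of_sobolev` lands unconditionally) — everything else BY NAME:
# (Γ2-W) ✓`exists_weakLimit_of_dyadicMeans` (★w8 g8), (Γ2-IBP) ✓`hasWeakFDerivOn_of_blowDown_pairings_subseq` (LEAD ★w1 g10),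
# (Γ2-lsc-ε) ✓`subcube_normSq_weakLimit_le_latticeEnergy_add` (px5 g8), ✓glue (w7 g13) inside ✓(L), and this seat's ✓(L)(M)(S)(C)(K-a)(K-b).

Cell `ym3-torus` (YM ladder rung R3 = continuum SU(2) Yang–Mills on T³ — a RUNG, NOT the Clay problem: not d = 4, not infinite volume, not a mass gap);
width seat `ym3-torus-px3` gen 8 (the Γ-KNIT pen, LEAD ★w1-19936 g10 12:29:32Z S2♭″ ARCHITECTURE v0).  THEOREMS ONLY (0 `def`, 0 `sorry`, default heartbeats);
`--supports stmt-QuantumFields-23533 --as helper`.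

THE KNIT (Luckhaus 1988 / Simon 1996 §2.9 on ℤ³, along Γ1's subsequence `φ₀`, NO further subsequence — `ψ = id`):
`G_μ` := the weak `L²(Q)` limits of the rescaled forward differences (Γ2-W, fed by ✓(M) `memLp_diffQuot` ∕ `setIntegral_normSq_diffQuot_le_of_energy`);
`G x := Σ_μ (proj μ).smulRight (G_μ x)`; `U` := the everywhere-unit representative of `U₀` (✓(S)); `HasWeakFDerivOn Q U G` by (Γ2-IBP) + ✓(S) a.e.-congruence;
`∫_Q dens ≤ Λ₀` from (Γ2-lsc-ε) at `t = 1`; minimality = ✓(K-a) `minimality_of_core` with ✓(S) locality for the outer identity and (Γ5) for the competitor;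
energy convergence = ✓(K-b) `energy_convergence_from_above` with (Γ5) for `U`.
HONEST SCOPE.  S2♭″ GIVEN (Γ5); S1″, `hHalvingBand`, K1, `MeanDeviationL`, `BlockLipschitzL`, `HistoryTailL` are NOT proved here; YM gap NOT proved.

References: S. Luckhaus, Indiana Univ. Math. J. 37 (1988) 349–367 [Luckhaus1988]; L. Simon, Theorems on Regularity and Singularity of Energy Minimizing
Maps (1996) §2.6, §2.9 [Simon1996]; R. Alicandro, M. Cicalese, SIAM J. Math. Anal. 2008 [AlicandroCicalese2008].
-/

set_option autoImplicit false

noncomputable section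

open scoped BigOperators RealInnerProductSpace
open MeasureTheory Set Finset Filter Topology

namespace Summit.QuantumFields.YangMills.Theorems.PoincareLipschitzLatticeToContinuumLimit

open Literature.MathematicalPhysics.QuantumFieldTheory.Balaban1983to89
open B4Eq19LatticeOperators (Zd box unitVec mem_box)
open Literature.Analysis.FunctionSpaces (HasWeakFDerivOn IsTestFunctionOn)
open Summit.QuantumFields.YangMills.Theorems.PoincareLipschitzLatticeToContinuumLatticeLetters (exists_glued_competitor_le)
open Summit.QuantumFields.YangMills.Theorems.PoincareLipschitzLatticeToContinuumCellLetters
open Summit.QuantumFields.YangMills.Theorems.PoincareLipschitzLatticeToContinuumSobolevLetters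
open Summit.QuantumFields.YangMills.Theorems.PoincareLipschitzLatticeToContinuumEnergyConvergence (energy_convergence_from_above)
open Summit.QuantumFields.YangMills.Theorems.PoincareLipschitzLatticeToContinuumMinimality (minimality_of_core)
open Summit.QuantumFields.YangMills.Theorems.PoincareLipschitzBlowDownWeakGradientLetters (sum_smulRight_apply_single)
open Summit.QuantumFields.YangMills.Theorems.PoincareLipschitzBlowDownWeakGradient (hasWeakFDerivOn_of_blowDown_pairings_subseq)
open Summit.QuantumFields.YangMills.Theorems.PoincareLipschitzBlowDownEnergyLscEps (subcube_normSq_weakLimit_le_latticeEnergy_add)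
open Summit.QuantumFields.YangMills.Theorems.PoincareLipschitzDyadicMeansWeakLimitCube (exists_weakLimit_of_dyadicMeans)

/-- ★★★ **(Γ-KNIT) S2♭″ `stub_latticeToContinuumLimit` (v1.4-band A″ text VERBATIM) FROM THE BRICKS, GIVEN (Γ5).**  The hypothesis `hΓ5` is the (Γ5) brick «Sobolev
sampling consistency» in the consumer's letters (w7 g13 SIGNATURE-0 ∕ px5 g8 door `exists_unit_sample_of_sobolev`): every `W^{1,2}` unit map on the cube with
integrable Dirichlet density admits, at every `(s, s′, η)`, unit lattice maps whose energy per unit scale on `Q_{⌊sR⌋}(0)` is `≤ ∫_{Q_{s′}} dens + η` and whose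
blow-downs are `η`-close in `L²(Q_s)`.  [cite: Luckhaus1988, Lemma 1 + Thm 2; Simon1996, §2.6 Lemma 1, §2.9 Lemma 1; AlicandroCicalese2008, Thm 4.1] -/
theorem latticeToContinuumLimit_of
    (hΓ5 : ∀ (hQ : IsOpen {x : EuclideanSpace ℝ (Fin 3) | ∀ i : Fin 3, |x i| < 1})
      (V : EuclideanSpace ℝ (Fin 3) → EuclideanSpace ℝ (Fin 4)) (GV : EuclideanSpace ℝ (Fin 3) → (EuclideanSpace ℝ (Fin 3) →L[ℝ] EuclideanSpace ℝ (Fin 4))),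
      HasWeakFDerivOn ⟨{x : EuclideanSpace ℝ (Fin 3) | ∀ i : Fin 3, |x i| < 1}, hQ⟩ volume V GV →
      (∀ x : EuclideanSpace ℝ (Fin 3), (∀ i : Fin 3, |x i| < 1) → ‖V x‖ = 1) →
      IntegrableOn (fun x => ∑ i : Fin 3, ‖GV x (EuclideanSpace.single i (1:ℝ))‖ ^ 2) {x : EuclideanSpace ℝ (Fin 3) | ∀ i : Fin 3, |x i| < 1} volume →
      ∀ (s s' η : ℝ), 0 < s → s < s' → s' < 1 → 0 < η → ∃ R₀ : ℕ, ∀ R : ℕ, R₀ ≤ R →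
        ∃ v : Zd 3 → EuclideanSpace ℝ (Fin 4), (∀ y, ‖v y‖ = 1) ∧
          (R : ℝ)⁻¹ * ∑ y ∈ box (0 : Zd 3) ⌊s * R⌋, ∑ μ : Fin 3, ‖v (y + unitVec μ) - v y‖ ^ 2 ≤
            (∫ x in {x : EuclideanSpace ℝ (Fin 3) | ∀ i : Fin 3, |x i| < s'}, ∑ i : Fin 3, ‖GV x (EuclideanSpace.single i (1:ℝ))‖ ^ 2) + η ∧
          ∫ x in {x : EuclideanSpace ℝ (Fin 3) | ∀ i : Fin 3, |x i| < s}, ‖v (fun i => ⌊(R : ℝ) * x i⌋) - V x‖ ^ 2 ≤ η) :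
    ∀ (Λ₀ : ℝ), 0 < Λ₀ → ∀ (u : ℕ → Zd 3 → EuclideanSpace ℝ (Fin 4)) (z : ℕ → Zd 3) (R : ℕ → ℤ),
      (∀ k : ℕ, (k : ℝ) + 1 ≤ R k) → (∀ (k : ℕ) (y : Zd 3), ‖u k y‖ = 1) →
      (∀ k : ℕ, (∀ (z' : Zd 3) (ρ : ℤ), 0 ≤ ρ → box z' (ρ + 1) ⊆ box (z k) (R k) →
        ∀ v : Zd 3 → EuclideanSpace ℝ (Fin 4), (∀ y, y ∉ box z' ρ → v y = (u k) y) → (∀ y ∈ box z' ρ, ‖v y‖ = 1) →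
        ∑ y ∈ box z' (ρ + 1), ∑ μ : Fin 3, ‖(u k) (y + unitVec μ) - (u k) y‖ ^ 2 ≤
        (∑ y ∈ box z' (ρ + 1), ∑ μ : Fin 3, ‖v (y + unitVec μ) - v y‖ ^ 2) + (1 / ((k : ℝ) + 1)) * ((ρ : ℝ) + 1))) →
      (∀ k : ℕ, ∑ y ∈ box (z k) (R k), ∑ μ : Fin 3, ‖(u k) (y + unitVec μ) - (u k) y‖ ^ 2 ≤ Λ₀ * R k) →
      ∀ (U₀ : EuclideanSpace ℝ (Fin 3) → EuclideanSpace ℝ (Fin 4)) (φ₀ : ℕ → ℕ), StrictMono φ₀ →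
      AEStronglyMeasurable U₀ (volume.restrict {x : EuclideanSpace ℝ (Fin 3) | ∀ i : Fin 3, |x i| < 1}) →
      (∀ᵐ x ∂(volume.restrict {x : EuclideanSpace ℝ (Fin 3) | ∀ i : Fin 3, |x i| < 1}), ‖U₀ x‖ = 1) →
      Tendsto (fun k : ℕ => ∫ x in {x : EuclideanSpace ℝ (Fin 3) | ∀ i : Fin 3, |x i| < 1},
            ‖u (φ₀ k) (z (φ₀ k) + fun i => ⌊(R (φ₀ k) : ℝ) * x i⌋) - U₀ x‖ ^ 2) atTop (𝓝 0) →
      (∀ (m : ℕ) (j : Fin 3 → Fin (2 ^ m)) (μ : Fin 3), ∃ g : EuclideanSpace ℝ (Fin 4),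
          Tendsto (fun k : ℕ => ∫ x in {x : EuclideanSpace ℝ (Fin 3) |
                ∀ i : Fin 3, (-1 : ℝ) + 2 * (j i : ℕ) / (2 : ℝ) ^ m ≤ x i ∧ x i < (-1 : ℝ) + 2 * ((j i : ℕ) + 1) / (2 : ℝ) ^ m},
              (R (φ₀ k) : ℝ) • (u (φ₀ k) ((z (φ₀ k) + fun i => ⌊(R (φ₀ k) : ℝ) * x i⌋) + unitVec μ)
                - u (φ₀ k) (z (φ₀ k) + fun i => ⌊(R (φ₀ k) : ℝ) * x i⌋))) atTop (𝓝 g)) →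
      ∀ (hQ : IsOpen {x : EuclideanSpace ℝ (Fin 3) | ∀ i : Fin 3, |x i| < 1}), ∃ (U : EuclideanSpace ℝ (Fin 3) → EuclideanSpace ℝ (Fin 4)) (G : EuclideanSpace ℝ (Fin 3) → (EuclideanSpace ℝ (Fin 3) →L[ℝ] EuclideanSpace ℝ (Fin 4))) (φ : ℕ → ℕ),
      StrictMono φ ∧ (∃ ψ : ℕ → ℕ, StrictMono ψ ∧ ∀ k : ℕ, φ k = φ₀ (ψ k)) ∧
      (∀ᵐ x ∂(volume.restrict {x : EuclideanSpace ℝ (Fin 3) | ∀ i : Fin 3, |x i| < 1}), U x = U₀ x) ∧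
      Literature.Analysis.FunctionSpaces.HasWeakFDerivOn ⟨{x : EuclideanSpace ℝ (Fin 3) | ∀ i : Fin 3, |x i| < 1}, hQ⟩ volume U G ∧
      (∀ x : EuclideanSpace ℝ (Fin 3), (∀ i : Fin 3, |x i| < 1) → ‖U x‖ = 1) ∧
      MeasureTheory.IntegrableOn (fun x => ∑ i : Fin 3, ‖G x (EuclideanSpace.single i (1:ℝ))‖ ^ 2)
        {x : EuclideanSpace ℝ (Fin 3) | ∀ i : Fin 3, |x i| < 1} ∧
      (∀ (V : EuclideanSpace ℝ (Fin 3) → EuclideanSpace ℝ (Fin 4)) (GV : EuclideanSpace ℝ (Fin 3) → (EuclideanSpace ℝ (Fin 3) →L[ℝ] EuclideanSpace ℝ (Fin 4))) (s : ℝ), s < 1 →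
        Literature.Analysis.FunctionSpaces.HasWeakFDerivOn ⟨{x : EuclideanSpace ℝ (Fin 3) | ∀ i : Fin 3, |x i| < 1}, hQ⟩ volume V GV →
        (∀ x : EuclideanSpace ℝ (Fin 3), (∀ i : Fin 3, |x i| < 1) → ‖V x‖ = 1) →
        MeasureTheory.IntegrableOn (fun x => ∑ i : Fin 3, ‖GV x (EuclideanSpace.single i (1:ℝ))‖ ^ 2)
        {x : EuclideanSpace ℝ (Fin 3) | ∀ i : Fin 3, |x i| < 1} →
        (∀ x : EuclideanSpace ℝ (Fin 3), (∃ i : Fin 3, s ≤ |x i|) → V x = U x) →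
        ∫ x in {x : EuclideanSpace ℝ (Fin 3) | ∀ i : Fin 3, |x i| < 1}, ∑ i : Fin 3, ‖G x (EuclideanSpace.single i (1:ℝ))‖ ^ 2 ≤
          ∫ x in {x : EuclideanSpace ℝ (Fin 3) | ∀ i : Fin 3, |x i| < 1}, ∑ i : Fin 3, ‖GV x (EuclideanSpace.single i (1:ℝ))‖ ^ 2) ∧
      ∫ x in {x : EuclideanSpace ℝ (Fin 3) | ∀ i : Fin 3, |x i| < 1}, ∑ i : Fin 3, ‖G x (EuclideanSpace.single i (1:ℝ))‖ ^ 2 ≤ Λ₀ ∧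
      ∀ (r₀ η : ℝ), 0 < r₀ → r₀ ≤ 1 / 8 → 0 < η → ∃ r : ℝ, r₀ / 2 ≤ r ∧ r ≤ r₀ ∧ ∃ k₀ : ℕ, ∀ k : ℕ, k₀ ≤ k →
        ∃ ρ : ℤ, r * (R (φ k) : ℝ) ≤ ρ ∧ (ρ : ℝ) ≤ 2 * r * R (φ k) ∧
        ∑ y ∈ box (z (φ k)) (2 * ρ), ∑ μ : Fin 3, ‖(u (φ k)) (y + unitVec μ) - (u (φ k)) y‖ ^ 2 ≤
          (R (φ k) : ℝ) * ((∫ x in {x : EuclideanSpace ℝ (Fin 3) | ∀ i : Fin 3, |x i| < (5 * r)}, ∑ i : Fin 3, ‖G x (EuclideanSpace.single i (1:ℝ))‖ ^ 2) + η) := by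
  intro Λ₀ hΛ₀ u z R hR hu hmin hE U₀ φ₀ hφ₀ hm₀ hu₀ hc₀ hg₀ hQ
  obtain ⟨C, hC0, hC⟩ := exists_glued_competitor_le
  haveI : IsFiniteMeasure (volume.restrict {x : EuclideanSpace ℝ (Fin 3) | ∀ i : Fin 3, |x i| < 1}) :=
    isFiniteMeasure_restrict.2 (volume_absCube_lt_top 1).ne
  have hRpos : ∀ k, (0 : ℤ) < R k := fun k => by
    have h1 := hR k; have h0 : (0:ℝ) ≤ (k : ℝ) := Nat.cast_nonneg _
    have : (0 : ℝ) < (R k : ℝ) := by linarith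
    exact_mod_cast this
  -- (Γ2-W): the weak limits `G μ` of the rescaled forward differences along `φ₀`
  have hW : ∀ μ : Fin 3, ∃ G : EuclideanSpace ℝ (Fin 3) → EuclideanSpace ℝ (Fin 4),
      MemLp G 2 (volume.restrict {x : EuclideanSpace ℝ (Fin 3) | ∀ i : Fin 3, |x i| < 1}) ∧
      ∫ x in {x : EuclideanSpace ℝ (Fin 3) | ∀ i : Fin 3, |x i| < 1}, ‖G x‖ ^ 2 ≤ Λ₀ ∧
      (∀ (m : ℕ) (j : Fin 3 → Fin (2 ^ m)),
        Tendsto (fun k : ℕ => ∫ x in {x : EuclideanSpace ℝ (Fin 3) | ∀ i : Fin 3,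
          (-1 : ℝ) + 2 * (j i : ℕ) / (2 : ℝ) ^ m ≤ x i ∧ x i < (-1 : ℝ) + 2 * ((j i : ℕ) + 1) / (2 : ℝ) ^ m},
            (R (φ₀ k) : ℝ) • (u (φ₀ k) ((z (φ₀ k) + fun i => ⌊(R (φ₀ k) : ℝ) * x i⌋) + unitVec μ)
              - u (φ₀ k) (z (φ₀ k) + fun i => ⌊(R (φ₀ k) : ℝ) * x i⌋)))
          atTop (𝓝 (∫ x in {x : EuclideanSpace ℝ (Fin 3) | ∀ i : Fin 3,
          (-1 : ℝ) + 2 * (j i : ℕ) / (2 : ℝ) ^ m ≤ x i ∧ x i < (-1 : ℝ) + 2 * ((j i : ℕ) + 1) / (2 : ℝ) ^ m}, G x))) ∧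
      (∀ ψ : EuclideanSpace ℝ (Fin 3) → EuclideanSpace ℝ (Fin 4),
        MemLp ψ 2 (volume.restrict {x : EuclideanSpace ℝ (Fin 3) | ∀ i : Fin 3, |x i| < 1}) →
        Tendsto (fun k : ℕ => ∫ x in {x : EuclideanSpace ℝ (Fin 3) | ∀ i : Fin 3, |x i| < 1},
            ⟪ψ x, (R (φ₀ k) : ℝ) • (u (φ₀ k) ((z (φ₀ k) + fun i => ⌊(R (φ₀ k) : ℝ) * x i⌋) + unitVec μ)
              - u (φ₀ k) (z (φ₀ k) + fun i => ⌊(R (φ₀ k) : ℝ) * x i⌋))⟫)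
          atTop (𝓝 (∫ x in {x : EuclideanSpace ℝ (Fin 3) | ∀ i : Fin 3, |x i| < 1}, ⟪ψ x, G x⟫))) ∧
      (∀ (φ : EuclideanSpace ℝ (Fin 3) → ℝ) (B : ℝ),
        AEStronglyMeasurable φ (volume.restrict {x : EuclideanSpace ℝ (Fin 3) | ∀ i : Fin 3, |x i| < 1}) →
        (∀ x, |φ x| ≤ B) →
        Tendsto (fun k : ℕ => ∫ x in {x : EuclideanSpace ℝ (Fin 3) | ∀ i : Fin 3, |x i| < 1},
            φ x • ((R (φ₀ k) : ℝ) • (u (φ₀ k) ((z (φ₀ k) + fun i => ⌊(R (φ₀ k) : ℝ) * x i⌋) + unitVec μ)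
              - u (φ₀ k) (z (φ₀ k) + fun i => ⌊(R (φ₀ k) : ℝ) * x i⌋))))
          atTop (𝓝 (∫ x in {x : EuclideanSpace ℝ (Fin 3) | ∀ i : Fin 3, |x i| < 1}, φ x • G x))) := fun μ =>
    exists_weakLimit_of_dyadicMeans
      (fun k x => (R (φ₀ k) : ℝ) • (u (φ₀ k) ((z (φ₀ k) + fun i => ⌊(R (φ₀ k) : ℝ) * x i⌋) + unitVec μ)
        - u (φ₀ k) (z (φ₀ k) + fun i => ⌊(R (φ₀ k) : ℝ) * x i⌋)))
      (fun k => memLp_diffQuot (u (φ₀ k)) (hu (φ₀ k)) (z (φ₀ k)) (R (φ₀ k) : ℝ) 1 μ) Λ₀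
      (fun k => setIntegral_normSq_diffQuot_le_of_energy (u (φ₀ k)) (z (φ₀ k)) (hRpos (φ₀ k)) μ (hE (φ₀ k)))
      (fun m j => hg₀ m j μ)
  choose G hGmem hGΛ hGmean hGpair hGφ using hW
  -- the everywhere-unit representative `U` of `U₀`
  obtain ⟨U, hUm, hU1, hUU₀⟩ := exists_unit_representative U₀ hm₀ hu₀
  have hconvU : Tendsto (fun k : ℕ => ∫ x in {x : EuclideanSpace ℝ (Fin 3) | ∀ i : Fin 3, |x i| < 1},
      ‖u (φ₀ k) (z (φ₀ k) + fun i => ⌊(R (φ₀ k) : ℝ) * x i⌋) - U x‖ ^ 2) atTop (𝓝 0) := by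
    refine hc₀.congr fun k => integral_congr_ae ?_
    filter_upwards [hUU₀] with x hx
    rw [hx]
  -- (Γ2-IBP): the weak gradient of `U₀`, hence of `U`
  have hGint : ∀ μ : Fin 3, IntegrableOn (G μ) {x : EuclideanSpace ℝ (Fin 3) | ∀ i : Fin 3, |x i| < 1} volume :=
    fun μ => (hGmem μ).integrable one_le_two
  have hpair : ∀ (μ : Fin 3) (ψ : EuclideanSpace ℝ (Fin 3) → ℝ),
      IsTestFunctionOn ⟨{x : EuclideanSpace ℝ (Fin 3) | ∀ i : Fin 3, |x i| < 1}, hQ⟩ ψ →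
      Tendsto (fun k : ℕ => ∫ x in {x : EuclideanSpace ℝ (Fin 3) | ∀ i : Fin 3, |x i| < 1},
          ψ x • ((R (φ₀ k) : ℝ) • (u (φ₀ k) ((z (φ₀ k) + fun i => ⌊(R (φ₀ k) : ℝ) * x i⌋) + unitVec μ)
            - u (φ₀ k) (z (φ₀ k) + fun i => ⌊(R (φ₀ k) : ℝ) * x i⌋))))
        atTop (𝓝 (∫ x in {x : EuclideanSpace ℝ (Fin 3) | ∀ i : Fin 3, |x i| < 1}, ψ x • G μ x)) := by
    intro μ ψ hψ
    obtain ⟨B, hB⟩ := hψ.hasCompactSupport.exists_bound_of_continuous hψ.contDiff.continuous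
    exact hGφ μ ψ B hψ.contDiff.continuous.aestronglyMeasurable fun x => by simpa only [Real.norm_eq_abs] using hB x
  have hW₀ := hasWeakFDerivOn_of_blowDown_pairings_subseq hQ u z R φ₀ hφ₀ hR hu U₀ hm₀ (hu₀.mono fun x hx => hx.le) hc₀ G hGint hpair
  have hWU := hasWeakFDerivOn_congr_ae hW₀ hUU₀
  -- the bundled gradient and its density
  set Gs : EuclideanSpace ℝ (Fin 3) → (EuclideanSpace ℝ (Fin 3) →L[ℝ] EuclideanSpace ℝ (Fin 4)) :=
    fun x => ∑ μ : Fin 3, (EuclideanSpace.proj μ).smulRight (G μ x) with hGs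
  have hdens : ∀ x, (∑ i : Fin 3, ‖Gs x (EuclideanSpace.single i (1:ℝ))‖ ^ 2) = ∑ i : Fin 3, ‖G i x‖ ^ 2 := fun x => by
    simp only [hGs, sum_smulRight_apply_single]
  have hdensU : IntegrableOn (fun x => ∑ i : Fin 3, ‖Gs x (EuclideanSpace.single i (1:ℝ))‖ ^ 2)
      {x : EuclideanSpace ℝ (Fin 3) | ∀ i : Fin 3, |x i| < 1} volume := by
    simp_rw [hdens]
    exact integrable_finsetSum _ fun i _ => (memLp_two_iff_integrable_sq_norm (hGmem i).1).1 (hGmem i)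
  -- (Γ2-lsc-ε) in the density letter
  have hlsc := subcube_normSq_weakLimit_le_latticeEnergy_add u z R φ₀ G hφ₀ hR hGmem hGpair
  have hlscU : ∀ (t ε : ℝ), 0 < t → t ≤ 1 → 0 < ε → ∃ k₀ : ℕ, ∀ k : ℕ, k₀ ≤ k →
      ∫ x in {x : EuclideanSpace ℝ (Fin 3) | ∀ i : Fin 3, |x i| < t}, (∑ i : Fin 3, ‖Gs x (EuclideanSpace.single i (1:ℝ))‖ ^ 2) ≤
        (R (φ₀ k) : ℝ)⁻¹ * (∑ y ∈ box (z (φ₀ k)) ⌈t * (R (φ₀ k) : ℝ)⌉, ∑ μ : Fin 3, ‖(u (φ₀ k)) (y + unitVec μ) - (u (φ₀ k)) y‖ ^ 2) + ε := by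
    simp_rw [hdens]; exact hlsc
  -- the energy bound `∫_Q dens ≤ Λ₀`
  have hEΛ : ∫ x in {x : EuclideanSpace ℝ (Fin 3) | ∀ i : Fin 3, |x i| < 1}, ∑ i : Fin 3, ‖Gs x (EuclideanSpace.single i (1:ℝ))‖ ^ 2 ≤ Λ₀ := by
    refine le_of_forall_pos_le_add fun ε hε => ?_
    obtain ⟨k₀, hk₀⟩ := hlscU 1 ε one_pos le_rfl hε
    refine (hk₀ k₀ le_rfl).trans ?_
    rw [ceil_one_mul_intCast]
    have hRr : (0 : ℝ) < (R (φ₀ k₀) : ℝ) := by exact_mod_cast hRpos (φ₀ k₀)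
    have := hE (φ₀ k₀)
    have h1 : (R (φ₀ k₀) : ℝ)⁻¹ * (∑ y ∈ box (z (φ₀ k₀)) (R (φ₀ k₀)), ∑ μ : Fin 3, ‖u (φ₀ k₀) (y + unitVec μ) - u (φ₀ k₀) y‖ ^ 2) ≤ Λ₀ := by
      rw [inv_mul_le_iff₀ hRr, mul_comm]; exact this
    linarith
  -- (Γ5) for `U`
  have hrecU := hΓ5 hQ U Gs hWU (fun x _ => hU1 x) hdensU
  refine ⟨U, Gs, φ₀, hφ₀, ⟨id, strictMono_id, fun k => rfl⟩, hUU₀, hWU, fun x _ => hU1 x, hdensU, ?_, hEΛ, ?_⟩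
  · -- (K-a) minimality
    intro V GV s hs1 hV hV1 hVint hVU
    exact minimality_of_core hC0 hC u z R hR hu hmin hE φ₀ hφ₀ U hUm hU1 hconvU _ hdensU hlscU V
      (aestronglyMeasurable_of_hasWeakFDerivOn hV) hV1 hs1 hVU _ hVint
      (fun s₃ hs₃ => dens_ae_eq_off_subcube hQ hWU hV hVU hs₃) (hΓ5 hQ V GV hV hV1 hVint)
  · -- (K-b) energy convergence from above
    exact energy_convergence_from_above hC0 hC u z R hR hu hmin hE φ₀ hφ₀ U hUm hU1 hconvU _ hrecU

end Summit.QuantumFields.YangMills.Theorems.PoincareLipschitzLatticeToContinuumLimit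

end
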